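import Literature.Computability.Complexity.CircuitEval
import Literature.Computability.Complexity.StackLists
import HarnessLib

/-!
# Route ArnoldMorseDeficit — list-level cell codes (objects the route posits)

The solution relation of `MorseDeficitCheckP` (stmt-PneNP-11730) speaks about cells
`c : (Fin n → ℕ) × (Fin n → Bool)` of the cubical torus `T^n_{2^m}` through their bit codes
`cellBits n m c` (the `m` binary digits of each coordinate, then the `n` orientation bits), the values
`val n m D c` assigned by the programs `D` (evaluated by `CircEval.evalFn`), and the counts of "bad"
facets / cofacets. The polynomial-time decider works on the LIST-LEVEL presentation of a cell — a list
of `n` coordinates and a string of `n` orientation bits — and this file fixes exactly those list-level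
objects (their agreement with the route's `Fin`-indexed ones and their polynomial-time computation are
proved in the sibling `ArnoldMorseDeficitMorseDeficitCheckP*.lean` files):

* `morseBits m v` — the `m` least significant binary digits of `v`; `morseCellBits m L B` — the code of
  the cell with coordinate list `L` and orientation string `B`;
* `morseVal D s` — the value of a cell code `s` under the programs `D`;
* `morseFacets`, `morseCofacets` — the codes of the `≤ 2n` facets / cofacets (coordinate shifts mod `2^m`);
* `morseUpBad`, `morseDownBad` — the numbers of cofacets of value `≤` / facets of value `≥` the cell's;
* `morseDecodeL`, `morseDecodeB` — reading a coordinate list and an orientation string off a cell code.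
-/

set_option linter.dupNamespace false -- `Summit.PneNP.PneNP.…`: summit = sub-problem name (D-0017 single-conjunct layout)

namespace Summit.PneNP.PneNP.Theorems

open Literature.Computability.Complexity

/-- The `m` least significant binary digits of `v` (least significant first). [folklore] -/
def morseBits (m v : ℕ) : List Bool := List.ofFn fun j : Fin m => v.testBit j

/-- The code of the cell with coordinate list `L` (each written with `m` bits) and orientation string `B`:
the coordinate digits, then `B` (the route's `cellBits`). [cite: AroraBarak2009, §0.1 (coding)] [folklore] -/
def morseCellBits (m : ℕ) (L : List ℕ) (B : List Bool) : List Bool := (L.map (morseBits m)).flatten ++ B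

/-- The value of a cell code `s` under the programs `D`: `Σ_j [D_j accepts s] · 2^j` (the route's `val`,
programs run by the universal evaluator `CircEval.evalFn`). [folklore] -/
def morseVal (D : List (List Bool)) (s : List Bool) : ℕ :=
  ((List.range D.length).map fun j => if CircEval.evalFn (boolPair s (D.getD j [])) = [true] then 2 ^ j else 0).sum

/-- The codes of the facets of the cell `(L, B)`: for each extended direction `i` (`B[i] = 1`) the two faces
`xᵢ` and `xᵢ + 1 (mod 2^m)` with direction `i` collapsed (the route's `facets`, coded). [folklore] -/
def morseFacets (m : ℕ) (L : List ℕ) (B : List Bool) : List (List Bool) :=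
  (List.range B.length).flatMap fun i => if B.getD i false then
    [morseCellBits m L (B.set i false), morseCellBits m (L.set i ((L.getD i 0 + 1) % 2 ^ m)) (B.set i false)]
    else []

/-- The codes of the cofacets of the cell `(L, B)`: for each collapsed direction `i` (`B[i] = 0`) the two
cofaces at `xᵢ` and `xᵢ - 1 (mod 2^m)` extended in direction `i` (the route's `cofacets`, coded). [folklore] -/
def morseCofacets (m : ℕ) (L : List ℕ) (B : List Bool) : List (List Bool) :=
  (List.range B.length).flatMap fun i => if B.getD i false then [] else
    [morseCellBits m L (B.set i true), morseCellBits m (L.set i ((L.getD i 0 + 2 ^ m - 1) % 2 ^ m)) (B.set i true)]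

/-- The number of cofacets whose value does not exceed the cell's (the route's `upBad`). [folklore] -/
def morseUpBad (m : ℕ) (D : List (List Bool)) (L : List ℕ) (B : List Bool) : ℕ :=
  ((morseCofacets m L B).filter fun t => decide (morseVal D t ≤ morseVal D (morseCellBits m L B))).length

/-- The number of facets whose value is not below the cell's (the route's `downBad`). [folklore] -/
def morseDownBad (m : ℕ) (D : List (List Bool)) (L : List ℕ) (B : List Bool) : ℕ :=
  ((morseFacets m L B).filter fun t => decide (morseVal D (morseCellBits m L B) ≤ morseVal D t)).length

/-- The coordinate list read off a cell code: `n` consecutive blocks of `m` bits, each read as a binary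
numeral (least significant digit first). [folklore] -/
def morseDecodeL (n m : ℕ) (cb : List Bool) : List ℕ :=
  (List.range n).map fun i => bitsToNat ((cb.drop (i * m)).take m)

/-- The orientation string read off a cell code: everything after the `n · m` coordinate digits. [folklore] -/
def morseDecodeB (n m : ℕ) (cb : List Bool) : List Bool := cb.drop (n * m)

end Summit.PneNP.PneNP.Theorems
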